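import Literature.AlgebraicGeometry.Motives.MixedHodgeStructureTensor
import Literature.AlgebraicGeometry.Motives.HodgeTensorMorphisms
import HarnessLib

/-!
# Morphisms of tensor products of mixed Hodge structures: `f ⊗ g`, symmetry, Tate twists

For mixed `ℚ`-Hodge structures on finite-dimensional spaces, the tensor product `H₁ ⊗ H₂`
(the tree's `MixedHodgeStructure.tensor`, Cattani–El Zein–Griffiths–Lê §3.2.2.7 (1):
`W_r = Σ_{i+j=r} W_i ⊗ W_j`, `F^r = Σ_{a+c=r} F^a ⊗ F^c`) is **functorial in morphisms of MHS**
(Deligne, *Hodge II*, 1.1.12: "`⊗` est un foncteur … de la catégorie des objets filtrés"; the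
morphisms of MHS are the maps compatible with both filtrations, 2.3.1), **symmetric**
(`H₁ ⊗ H₂ ≅ H₂ ⊗ H₁` by `v ⊗ w ↦ w ⊗ v`), and **compatible with Tate twists**
(`H₁(j) ⊗ H₂ = (H₁ ⊗ H₂)(j) = H₁ ⊗ H₂(j)`, Deligne 2.1.13–2.1.14: `H(j) = H ⊗ ℚ(j)`).

## Main results (definitions with bodies and theorems; no named facts)

* `tensor_F_eq_comap_tmulFiltration` — `F^r(H₁ ⊗ H₂)` is Deligne's filtration
  `HodgeStructure.tmulFiltration H₁.F H₂.F r` (`Σ_{a+b ≥ r} F^a ⊗ F^b`, `Motives/HodgeTensorMorphisms`)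
  pulled back along `ℂ ⊗ (V ⊗ V') ≃ V_ℂ ⊗_ℂ V'_ℂ`.
* **`Hom.tensorMap f g : Hom (H₁ ⊗ H₂) (K₁ ⊗ K₂)`** (underlying map `TensorProduct.map f g`),
  `tensorMap_comp`, `tensorMap_id`.
* **`tensorComm H₁ H₂ : Hom (H₁ ⊗ H₂) (H₂ ⊗ H₁)`** (underlying map `TensorProduct.comm`),
  `tensorComm_comp_tensorComm`, `tensorComm_bijective`.
* **`tensor_tateTwist_left`**, **`tensor_tateTwist_right`** — `H₁(j) ⊗ H₂ = (H₁ ⊗ H₂)(j) = H₁ ⊗ H₂(j)`.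

## References

* [DeligneHodgeII1971] P. Deligne, Théorie de Hodge II, 1.1.12, 2.1.13–2.1.14, 2.3.1.
* [CattaniElZeinGriffithsLe2014] E. Cattani et al. (eds.), *Hodge Theory* (2014), §3.2.2.7 (1),
  Def. 3.2.16 (morphisms of MHS).
-/

noncomputable section

open scoped TensorProduct

namespace Literature.AlgebraicGeometry.Motives

namespace MixedHodgeStructure

universe u v u' v' u'' v''

variable {V : Type u} [AddCommGroup V] [Module ℚ V]
variable {V' : Type v} [AddCommGroup V'] [Module ℚ V']
variable {U : Type u'} [AddCommGroup U] [Module ℚ U]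
variable {U' : Type v'} [AddCommGroup U'] [Module ℚ U']
variable {X : Type u''} [AddCommGroup X] [Module ℚ X]
variable {X' : Type v''} [AddCommGroup X'] [Module ℚ X']

open Module
open HodgeStructure (tensorBaseChange tensorBaseChange_tmul tmulFiltration map_tmulFiltration_le)

/-! ### Linear algebra -/

/-- `(f ⊗ g)(A ⊗ B) ⊆ f(A) ⊗ g(B)`. [folklore] -/
private theorem map_map₂_mk_le (f : V →ₗ[ℚ] U) (g : V' →ₗ[ℚ] U') (A : Submodule ℚ V)
    (B : Submodule ℚ V') :
    (Submodule.map₂ (TensorProduct.mk ℚ V V') A B).map (TensorProduct.map f g) ≤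
      Submodule.map₂ (TensorProduct.mk ℚ U U') (A.map f) (B.map g) := by
  rw [Submodule.map_le_iff_le_comap, Submodule.map₂_le]
  intro a ha b hb
  rw [Submodule.mem_comap, TensorProduct.mk_apply, TensorProduct.map_tmul]
  exact Submodule.apply_mem_map₂ _ (Submodule.mem_map_of_mem ha) (Submodule.mem_map_of_mem hb)

/-- `σ(A ⊗ B) ⊆ B ⊗ A` for the symmetry `σ : V ⊗ V' ≃ V' ⊗ V`. [folklore] -/
private theorem map_comm_map₂_mk_le (A : Submodule ℚ V) (B : Submodule ℚ V') :
    (Submodule.map₂ (TensorProduct.mk ℚ V V') A B).map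
        (TensorProduct.comm ℚ V V' : V ⊗[ℚ] V' →ₗ[ℚ] V' ⊗[ℚ] V) ≤
      Submodule.map₂ (TensorProduct.mk ℚ V' V) B A := by
  rw [Submodule.map_le_iff_le_comap, Submodule.map₂_le]
  intro a ha b hb
  rw [Submodule.mem_comap, TensorProduct.mk_apply, LinearEquiv.coe_coe, TensorProduct.comm_tmul]
  exact Submodule.apply_mem_map₂ _ hb ha

/-- `tensorBaseChange` is natural in pairs of linear maps: `e ((f ⊗ g) ⊗ ℂ) = ((f ⊗ ℂ) ⊗ (g ⊗ ℂ)) e`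
(as in `Motives/HodgeTensorMorphisms`, where it is private). [folklore] -/
private theorem tensorBaseChange_map_baseChange (f : V →ₗ[ℚ] U) (g : V' →ₗ[ℚ] U')
    (x : ℂ ⊗[ℚ] (V ⊗[ℚ] V')) :
    tensorBaseChange U U' ((TensorProduct.map f g).baseChange ℂ x) =
      TensorProduct.map (f.baseChange ℂ) (g.baseChange ℂ) (tensorBaseChange V V' x) := by
  induction x using TensorProduct.induction_on with
  | zero => simp only [map_zero]
  | add x y hx hy => simp only [map_add, hx, hy]
  | tmul c z =>
    induction z using TensorProduct.induction_on with
    | zero => simp only [TensorProduct.tmul_zero, map_zero]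
    | add x y hx hy => simp only [TensorProduct.tmul_add, map_add, hx, hy]
    | tmul v w =>
      simp only [LinearMap.baseChange_tmul, TensorProduct.map_tmul, tensorBaseChange_tmul]

/-- `tensorBaseChange` is natural for the symmetry: `e (σ ⊗ ℂ) = σ_ℂ e`. [folklore] -/
private theorem tensorBaseChange_comm_baseChange (x : ℂ ⊗[ℚ] (V ⊗[ℚ] V')) :
    tensorBaseChange V' V ((TensorProduct.comm ℚ V V' : V ⊗[ℚ] V' →ₗ[ℚ] V' ⊗[ℚ] V).baseChange ℂ x) =
      TensorProduct.comm ℂ (ℂ ⊗[ℚ] V) (ℂ ⊗[ℚ] V') (tensorBaseChange V V' x) := by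
  induction x using TensorProduct.induction_on with
  | zero => simp only [map_zero]
  | add x y hx hy => simp only [map_add, hx, hy]
  | tmul c z =>
    induction z using TensorProduct.induction_on with
    | zero => simp only [TensorProduct.tmul_zero, map_zero]
    | add x y hx hy => simp only [TensorProduct.tmul_add, map_add, hx, hy]
    | tmul v w =>
      simp only [LinearMap.baseChange_tmul, LinearEquiv.coe_coe, TensorProduct.comm_tmul,
        tensorBaseChange_tmul]
      rw [show (c ⊗ₜ[ℚ] w : ℂ ⊗[ℚ] V') = c • ((1 : ℂ) ⊗ₜ[ℚ] w) by
          rw [TensorProduct.smul_tmul', smul_eq_mul, mul_one],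
        show (c ⊗ₜ[ℚ] v : ℂ ⊗[ℚ] V) = c • ((1 : ℂ) ⊗ₜ[ℚ] v) by
          rw [TensorProduct.smul_tmul', smul_eq_mul, mul_one]]
      exact TensorProduct.smul_tmul c _ _

/-- `σ(F^p(Y₁ ⊗ Y₂)) ⊆ F^p(Y₂ ⊗ Y₁)` for Deligne's filtration and the symmetry `σ`. [folklore] -/
private theorem map_comm_tmulFiltration_le {R : Type*} [CommRing R] {Y₁ : Type*} [AddCommGroup Y₁]
    [Module R Y₁] {Y₂ : Type*} [AddCommGroup Y₂] [Module R Y₂] (G₁ : ℤ → Submodule R Y₁)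
    (G₂ : ℤ → Submodule R Y₂) (p : ℤ) :
    (tmulFiltration G₁ G₂ p).map (TensorProduct.comm R Y₁ Y₂ : Y₁ ⊗[R] Y₂ →ₗ[R] Y₂ ⊗[R] Y₁) ≤
      tmulFiltration G₂ G₁ p := by
  rw [HodgeStructure.tmulFiltration_eq_span, Submodule.map_span, Submodule.span_le]
  rintro _ ⟨_, ⟨a, b, x, y, hab, hx, hy, rfl⟩, rfl⟩
  rw [LinearEquiv.coe_coe, TensorProduct.comm_tmul]
  exact HodgeStructure.tmul_mem_tmulFiltration G₂ G₁ b a (by omega) hy hx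

variable (H₁ : MixedHodgeStructure V) (H₂ : MixedHodgeStructure V')

/-! ### The Hodge filtration of `H₁ ⊗ H₂` as Deligne's filtration of filtered objects -/

/-- **`F^r(H₁ ⊗ H₂) = Σ_{a+b ≥ r} F^a ⊗ F^b`** pulled back along `ℂ ⊗ (V ⊗ V') ≃ V_ℂ ⊗_ℂ V'_ℂ`: the
Hodge filtration of the MHS tensor product (`tensor_F`: `Σ_{a+b = r}`) is Deligne's filtration of the
tensor product of the filtered objects `(V_ℂ, F)`, `(V'_ℂ, F)` (the tree's
`HodgeStructure.tmulFiltration`, with `≥`; the same subspace since `F` is decreasing).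
[cite: DeligneHodgeII1971, 1.1.12] -/
theorem tensor_F_eq_comap_tmulFiltration [FiniteDimensional ℚ V] [FiniteDimensional ℚ V'] (r : ℤ) :
    (tensor H₁ H₂).F r =
      (tmulFiltration H₁.F H₂.F r).comap (tensorBaseChange V V' : ℂ ⊗[ℚ] (V ⊗[ℚ] V') →ₗ[ℂ] _) := by
  rw [tensor_F, HodgeStructure.tmulFiltration]
  simp only [TensorProduct.range_mapIncl, Submodule.comap_equiv_eq_map_symm, Submodule.map_iSup]
  apply le_antisymm
  · refine iSup₂_le fun ac (hac : ac.1 + ac.2 = r) => ?_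
    exact le_iSup_of_le ac.1 (le_iSup_of_le ac.2 (le_iSup_of_le (show r ≤ ac.1 + ac.2 by omega) le_rfl))
  · refine iSup_le fun a => iSup_le fun b => iSup_le fun hab => ?_
    refine (Submodule.map_mono (Submodule.map₂_le_map₂_right
      (H₂.antitone_F (show r - a ≤ b by omega)))).trans ?_
    exact le_biSup (fun ac : ℤ × ℤ => ((Submodule.map₂ (TensorProduct.mk ℂ (ℂ ⊗[ℚ] V) (ℂ ⊗[ℚ] V'))
        (H₁.F ac.1) (H₂.F ac.2)).map ((tensorBaseChange V V').symm : _ →ₗ[ℂ] ℂ ⊗[ℚ] (V ⊗[ℚ] V'))))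
      (i := (a, r - a)) (show a + (r - a) = r by omega)

/-! ### `f ⊗ g` -/

section TensorMap

variable [FiniteDimensional ℚ V] [FiniteDimensional ℚ V'] [FiniteDimensional ℚ U]
  [FiniteDimensional ℚ U'] [FiniteDimensional ℚ X] [FiniteDimensional ℚ X']

/-- **The tensor product `f ⊗ g : H₁ ⊗ H₂ → K₁ ⊗ K₂` of two morphisms of mixed Hodge structures**
(underlying map Mathlib's `TensorProduct.map f g`): `(f ⊗ g)(W_i ⊗ W_j) ⊆ f(W_i) ⊗ g(W_j) ⊆ W_i ⊗ W_j`
and `(f ⊗ g)_ℂ(F^a ⊗ F^b) ⊆ F^a ⊗ F^b` (Deligne, Hodge II, 1.1.12: `⊗` is a functor of filtered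
objects; the tree's `HodgeStructure.map_tmulFiltration_le`). [cite: DeligneHodgeII1971, 1.1.12] -/
def Hom.tensorMap {H₁ : MixedHodgeStructure V} {H₂ : MixedHodgeStructure V'}
    {K₁ : MixedHodgeStructure U} {K₂ : MixedHodgeStructure U'} (f : Hom H₁ K₁) (g : Hom H₂ K₂) :
    Hom (tensor H₁ H₂) (tensor K₁ K₂) where
  toLinearMap := TensorProduct.map f.toLinearMap g.toLinearMap
  map_W_le n := by
    rw [tensor_W, tensor_W]
    simp only [Submodule.map_iSup]
    refine iSup₂_le fun ij hij => ?_
    refine ((map_map₂_mk_le _ _ _ _).trans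
      (Submodule.map₂_le_map₂ (f.map_W_le ij.1) (g.map_W_le ij.2))).trans ?_
    exact le_biSup (fun ij : ℤ × ℤ =>
      Submodule.map₂ (TensorProduct.mk ℚ U U') (K₁.W ij.1) (K₂.W ij.2)) hij
  map_F_le p := by
    rw [tensor_F_eq_comap_tmulFiltration, tensor_F_eq_comap_tmulFiltration,
      Submodule.map_le_iff_le_comap]
    intro Z hZ
    rw [Submodule.mem_comap] at hZ
    rw [Submodule.mem_comap, Submodule.mem_comap, LinearEquiv.coe_coe,
      tensorBaseChange_map_baseChange]
    exact map_tmulFiltration_le H₁.F H₂.F K₁.F K₂.F (f.toLinearMap.baseChange ℂ)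
      (g.toLinearMap.baseChange ℂ) f.map_F_le g.map_F_le p ⟨_, hZ, rfl⟩

/-- The underlying map of `f ⊗ g`. [cite: DeligneHodgeII1971, 1.1.12] -/
@[simp]
theorem Hom.tensorMap_toLinearMap {H₁ : MixedHodgeStructure V} {H₂ : MixedHodgeStructure V'}
    {K₁ : MixedHodgeStructure U} {K₂ : MixedHodgeStructure U'} (f : Hom H₁ K₁) (g : Hom H₂ K₂) :
    (f.tensorMap g).toLinearMap = TensorProduct.map f.toLinearMap g.toLinearMap :=
  rfl

/-- `f ⊗ g` on pure tensors. [cite: DeligneHodgeII1971, 1.1.12] -/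
@[simp]
theorem Hom.tensorMap_apply_tmul {H₁ : MixedHodgeStructure V} {H₂ : MixedHodgeStructure V'}
    {K₁ : MixedHodgeStructure U} {K₂ : MixedHodgeStructure U'} (f : Hom H₁ K₁) (g : Hom H₂ K₂)
    (x : V) (y : V') :
    (f.tensorMap g).toLinearMap (x ⊗ₜ[ℚ] y) = f.toLinearMap x ⊗ₜ[ℚ] g.toLinearMap y :=
  rfl

/-- **Functoriality**: `(f' ∘ f) ⊗ (g' ∘ g) = (f' ⊗ g') ∘ (f ⊗ g)`. [cite: DeligneHodgeII1971, 1.1.12] -/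
theorem Hom.tensorMap_comp {H₁ : MixedHodgeStructure V} {H₂ : MixedHodgeStructure V'}
    {K₁ : MixedHodgeStructure U} {K₂ : MixedHodgeStructure U'} {L₁ : MixedHodgeStructure X}
    {L₂ : MixedHodgeStructure X'} (f' : Hom K₁ L₁) (f : Hom H₁ K₁) (g' : Hom K₂ L₂)
    (g : Hom H₂ K₂) :
    (f'.comp f).tensorMap (g'.comp g) = (f'.tensorMap g').comp (f.tensorMap g) :=
  Hom.ext (TensorProduct.map_comp _ _ _ _)

/-- **Functoriality**: `id ⊗ id = id`. [cite: DeligneHodgeII1971, 1.1.12] -/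
theorem Hom.tensorMap_id (H₁ : MixedHodgeStructure V) (H₂ : MixedHodgeStructure V') :
    (Hom.id H₁).tensorMap (Hom.id H₂) = Hom.id (tensor H₁ H₂) :=
  Hom.ext TensorProduct.map_id

end TensorMap

/-! ### Symmetry -/

section Comm

variable [FiniteDimensional ℚ V] [FiniteDimensional ℚ V']

/-- **The symmetry `H₁ ⊗ H₂ → H₂ ⊗ H₁`, `v ⊗ w ↦ w ⊗ v`, is a morphism of mixed Hodge structures**
(`σ(W_i ⊗ W_j) = W_j ⊗ W_i`, `σ_ℂ(F^a ⊗ F^b) = F^b ⊗ F^a`; Deligne, Hodge II, 1.1.12 — the tensor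
product of filtered objects is a symmetric construction). [cite: DeligneHodgeII1971, 1.1.12] -/
def tensorComm : Hom (tensor H₁ H₂) (tensor H₂ H₁) where
  toLinearMap := (TensorProduct.comm ℚ V V' : V ⊗[ℚ] V' →ₗ[ℚ] V' ⊗[ℚ] V)
  map_W_le n := by
    rw [tensor_W, tensor_W]
    simp only [Submodule.map_iSup]
    refine iSup₂_le fun ij (hij : ij.1 + ij.2 = n) => ?_
    refine (map_comm_map₂_mk_le _ _).trans ?_
    exact le_biSup (fun ij : ℤ × ℤ =>
      Submodule.map₂ (TensorProduct.mk ℚ V' V) (H₂.W ij.1) (H₁.W ij.2)) (i := (ij.2, ij.1))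
      (show ij.2 + ij.1 = n by omega)
  map_F_le p := by
    rw [tensor_F_eq_comap_tmulFiltration, tensor_F_eq_comap_tmulFiltration,
      Submodule.map_le_iff_le_comap]
    intro Z hZ
    rw [Submodule.mem_comap] at hZ
    rw [Submodule.mem_comap, Submodule.mem_comap, LinearEquiv.coe_coe,
      tensorBaseChange_comm_baseChange]
    exact map_comm_tmulFiltration_le H₁.F H₂.F p ⟨_, hZ, rfl⟩

/-- The underlying map of the symmetry is `TensorProduct.comm`. [cite: DeligneHodgeII1971, 1.1.12] -/
@[simp]
theorem tensorComm_toLinearMap :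
    (tensorComm H₁ H₂).toLinearMap = (TensorProduct.comm ℚ V V' : V ⊗[ℚ] V' →ₗ[ℚ] V' ⊗[ℚ] V) :=
  rfl

/-- `σ_{H₂,H₁} ∘ σ_{H₁,H₂} = id`. [cite: DeligneHodgeII1971, 1.1.12] -/
theorem tensorComm_comp_tensorComm :
    (tensorComm H₂ H₁).comp (tensorComm H₁ H₂) = Hom.id (tensor H₁ H₂) :=
  Hom.ext (LinearMap.ext fun x => (TensorProduct.comm ℚ V V').symm_apply_apply x)

/-- The symmetry `H₁ ⊗ H₂ ≅ H₂ ⊗ H₁` is an isomorphism of MHS. [cite: DeligneHodgeII1971, 1.1.12] -/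
theorem tensorComm_bijective : Function.Bijective (tensorComm H₁ H₂).toLinearMap :=
  (TensorProduct.comm ℚ V V').bijective

end Comm

/-! ### Tate twists -/

section TateTwist

variable [FiniteDimensional ℚ V] [FiniteDimensional ℚ V']

/-- **`H₁(j) ⊗ H₂ = (H₁ ⊗ H₂)(j)`** as mixed Hodge structures on `V ⊗ V'`
(`W_n(H₁(j) ⊗ H₂) = Σ_{i+k=n} W_{i+2j} ⊗ W_k = W_{n+2j}(H₁ ⊗ H₂)`,
`F^r = Σ_{a+c=r} F^{a+j} ⊗ F^c = F^{r+j}(H₁ ⊗ H₂)`; Deligne, Hodge II, 2.1.13–2.1.14: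
`H(j) = H ⊗ ℚ(j)`). [cite: DeligneHodgeII1971, 1.1.12 and 2.1.14] -/
theorem tensor_tateTwist_left (j : ℤ) :
    tensor (H₁.tateTwist j) H₂ = (tensor H₁ H₂).tateTwist j := by
  refine ext_of_W_F (funext fun n => ?_) (funext fun r => ?_)
  · rw [tateTwist_W, tensor_W, tensor_W]
    simp only [tateTwist_W]
    apply le_antisymm
    · refine iSup₂_le fun ik (hik : ik.1 + ik.2 = n) => ?_
      exact le_biSup (fun ij : ℤ × ℤ =>
          Submodule.map₂ (TensorProduct.mk ℚ V V') (H₁.W ij.1) (H₂.W ij.2))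
        (i := (ik.1 + 2 * j, ik.2)) (show ik.1 + 2 * j + ik.2 = n + 2 * j by omega)
    · refine iSup₂_le fun ij (hij : ij.1 + ij.2 = n + 2 * j) => ?_
      refine le_iSup₂_of_le (f := fun (ik : ℤ × ℤ) (_ : ik ∈ {ik : ℤ × ℤ | ik.1 + ik.2 = n}) =>
          Submodule.map₂ (TensorProduct.mk ℚ V V') (H₁.W (ik.1 + 2 * j)) (H₂.W ik.2))
        (ij.1 - 2 * j, ij.2) (show ij.1 - 2 * j + ij.2 = n by omega) ?_
      show _ ≤ Submodule.map₂ _ (H₁.W (ij.1 - 2 * j + 2 * j)) (H₂.W ij.2)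
      rw [sub_add_cancel]
  · rw [tateTwist_F, tensor_F, tensor_F]
    simp only [tateTwist_F]
    apply le_antisymm
    · refine iSup₂_le fun ac (hac : ac.1 + ac.2 = r) => ?_
      exact le_biSup (fun ac : ℤ × ℤ =>
          (Submodule.map₂ (TensorProduct.mk ℂ (ℂ ⊗[ℚ] V) (ℂ ⊗[ℚ] V')) (H₁.F ac.1) (H₂.F ac.2)).comap
            (tensorBaseChange V V' : ℂ ⊗[ℚ] (V ⊗[ℚ] V') →ₗ[ℂ] _))
        (i := (ac.1 + j, ac.2)) (show ac.1 + j + ac.2 = r + j by omega)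
    · refine iSup₂_le fun ac (hac : ac.1 + ac.2 = r + j) => ?_
      have h : H₁.F ac.1 = H₁.F (ac.1 - j + j) := by rw [sub_add_cancel]
      rw [h]
      exact le_biSup (fun ac : ℤ × ℤ =>
          (Submodule.map₂ (TensorProduct.mk ℂ (ℂ ⊗[ℚ] V) (ℂ ⊗[ℚ] V')) (H₁.F (ac.1 + j)) (H₂.F ac.2)).comap
            (tensorBaseChange V V' : ℂ ⊗[ℚ] (V ⊗[ℚ] V') →ₗ[ℂ] _))
        (i := (ac.1 - j, ac.2)) (show ac.1 - j + ac.2 = r by omega)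

/-- **`H₁ ⊗ H₂(j) = (H₁ ⊗ H₂)(j)`** as mixed Hodge structures on `V ⊗ V'`.
[cite: DeligneHodgeII1971, 1.1.12 and 2.1.14] -/
theorem tensor_tateTwist_right (j : ℤ) :
    tensor H₁ (H₂.tateTwist j) = (tensor H₁ H₂).tateTwist j := by
  refine ext_of_W_F (funext fun n => ?_) (funext fun r => ?_)
  · rw [tateTwist_W, tensor_W, tensor_W]
    simp only [tateTwist_W]
    apply le_antisymm
    · refine iSup₂_le fun ik (hik : ik.1 + ik.2 = n) => ?_
      exact le_biSup (fun ij : ℤ × ℤ =>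
          Submodule.map₂ (TensorProduct.mk ℚ V V') (H₁.W ij.1) (H₂.W ij.2))
        (i := (ik.1, ik.2 + 2 * j)) (show ik.1 + (ik.2 + 2 * j) = n + 2 * j by omega)
    · refine iSup₂_le fun ij (hij : ij.1 + ij.2 = n + 2 * j) => ?_
      refine le_iSup₂_of_le (f := fun (ik : ℤ × ℤ) (_ : ik ∈ {ik : ℤ × ℤ | ik.1 + ik.2 = n}) =>
          Submodule.map₂ (TensorProduct.mk ℚ V V') (H₁.W ik.1) (H₂.W (ik.2 + 2 * j)))
        (ij.1, ij.2 - 2 * j) (show ij.1 + (ij.2 - 2 * j) = n by omega) ?_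
      show _ ≤ Submodule.map₂ _ (H₁.W ij.1) (H₂.W (ij.2 - 2 * j + 2 * j))
      rw [sub_add_cancel]
  · rw [tateTwist_F, tensor_F, tensor_F]
    simp only [tateTwist_F]
    apply le_antisymm
    · refine iSup₂_le fun ac (hac : ac.1 + ac.2 = r) => ?_
      exact le_biSup (fun ac : ℤ × ℤ =>
          (Submodule.map₂ (TensorProduct.mk ℂ (ℂ ⊗[ℚ] V) (ℂ ⊗[ℚ] V')) (H₁.F ac.1) (H₂.F ac.2)).comap
            (tensorBaseChange V V' : ℂ ⊗[ℚ] (V ⊗[ℚ] V') →ₗ[ℂ] _))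
        (i := (ac.1, ac.2 + j)) (show ac.1 + (ac.2 + j) = r + j by omega)
    · refine iSup₂_le fun ac (hac : ac.1 + ac.2 = r + j) => ?_
      have h : H₂.F ac.2 = H₂.F (ac.2 - j + j) := by rw [sub_add_cancel]
      rw [h]
      exact le_biSup (fun ac : ℤ × ℤ =>
          (Submodule.map₂ (TensorProduct.mk ℂ (ℂ ⊗[ℚ] V) (ℂ ⊗[ℚ] V')) (H₁.F ac.1) (H₂.F (ac.2 + j))).comap
            (tensorBaseChange V V' : ℂ ⊗[ℚ] (V ⊗[ℚ] V') →ₗ[ℂ] _))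
        (i := (ac.1, ac.2 - j)) (show ac.1 + (ac.2 - j) = r by omega)

end TateTwist

end MixedHodgeStructure

end Literature.AlgebraicGeometry.Motives

end
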